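import Summits.HodgeConjecture.HodgeConjecture.Theorems.F0P3cStCharTSShellsTT             -- ★ p850427 (this seat): `shellsTT_of_datum` (transform = two-coset step function, `κ ≠ 0` explicit, mass)
import HarnessLib

/-!
# F0 · P3c · line LH6 «StCharTS» — «SHELL-VALUE★»: the point value of `D·α` at a dominant chart point from the Hecke-shell average of a class function `α`
# («Casselman on the split torus», the bridge (WIF°) + «SHELLS-TT» ⇒ pointwise) [Rogawski1990, §12.7 L. 12.7.2 (proof) p. 193; §12.5 p. 182]

Cell `pub/hodgecm-mathlib`, crux H413 = `stmt-HodgeConjecture-24833` (`--supports`, helper lane), route HCCMUnconditional; seat LH6-p05 (g3) (DEFAULT-by-lineage brick toward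
the (TOR⁗) residue (L1M)∕(L1M-up) of the LH6 leaf package, after the census `F0/P3b/LH6-p05/g3/CENSUS-L1M-road.LH6p05g3.md` and LH6-p01 (g3)'s memo b00e65f2).
THEOREMS ONLY, sorry-free, ★-only imports, no definition ∕ instance ∕ notation ∕ named fact.

THE MATHEMATICS.  Binders of ★ `shellsTT_of_datum` (datum `𝓘`, level `n` deep at `w` and normalised by `w₀`, dominant chart point `u = (α₀, z)`, `|α₀|_w < 1`, F1-G dominance at
`ι u`, a transversal `R`), a density `ρ : M → ℝ` and a function `α` on `U(Φ₃)(L⁺_v)`.  Put `φ := 𝟙_{K_n ι(u) K_n}`, `M_n := ι⁻¹(M_T ∩ K_n)`, `F := ρ · (α ∘ ι)`.  ASSUME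
(i) the Weyl identity AT `φ`: `∫ φ·α dν = ∫_M F_φ · F dμM` ((WIF°) of ★ `F0P3cStCharTSWeylCoreDensity.weylIntegration_core_of_shells`, or any later density — the
hypothesis is the single instance used); (ii) `F` is constant on the coset `u·M_n` (Harish-Chandra local constancy of `α` on `G^r` + `n` large); (iii) `F(ω m) = F(m)` on
`u·M_n` (`α` a class function: `ι(ω m) = w₀ ι(m) w₀⁻¹`; `ρ ∘ ω = ρ`).  THEN (`shellValue`)
  `F(u) · (‖α₀‖ · ∫ φ dν) = ∫ φ·α dν`,  i.e.  `D(ι u)·α(ι u) = (∫ 𝟙_{K_n ι u K_n}·α dν) ∕ (‖α₀‖ · ν(K_n ι u K_n))`.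
Proof: `F_φ = κ·(𝟙_{u M_n} + 𝟙_{u M_n} ∘ ω)` and `(∫ φ dν)·‖α₀‖ = 2κ·μM(u M_n)` (★ «SHELLS-TT»; `δ_B^{1∕2}(ι u) = ‖α₀‖` ★ `rootDeltaChar_cmBorel_torus`); pointwise
`F_φ · F = κ·F(u)·(𝟙_{u M_n} + 𝟙_{ω⁻¹(u M_n)})` by (ii)(iii) and `ω ∘ ω = id`; `μM(ω⁻¹(u M_n)) = μM(u M_n)` (★ `measurePreserving_reflect`, LH6-p05 (g2)).
Sanity: `α ≡ 1` gives `ρ(u) = ‖α₀‖⁻¹` — print's `D_G = δ^{1∕2}(γ)⁻¹` on the contracting half [L. 12.7.2 proof p. 193].  USE: with `α := χ_σ` and ★ R2d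
`Representation.smoothTrace_indicator_shell_eq` (`Tr σ(𝟙_{K_n t K_n})` = normalised Jacquet trace at `t`), the right side is Casselman's Jacquet-module value, and (L1M) off
`M_c` reduces to the exponent decay ★ `norm_exponent_lt_one_of_isSquareIntegrableModCenter` summed over the shells.
HONEST LABEL: count-neutral; HC_CM is proved only modulo the 7 printed citations (2 remaining: hLiu418 = stmt-HodgeConjecture-24832, h413 = stmt-HodgeConjecture-24833)
until rung 0 closes.

## References
* [Rogawski1990] J. D. Rogawski, *Automorphic Representations of Unitary Groups in Three Variables*, Ann. of Math. Stud. 123 (1990): §12.5 p. 182; §12.7 L. 12.7.2 (proof)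
  p. 193.
* [Casselman1977] W. Casselman, *Characters and Jacquet modules*, Math. Ann. 230 (1977), Thm. 5.2.
-/

set_option autoImplicit false
-- the mandated namespace has the single-problem summit's repeated segment (`HodgeConjecture.HodgeConjecture`)
set_option linter.dupNamespace false

noncomputable section

open NumberField IsDedekindDomain MeasureTheory Measure Topology Filter
open scoped NNReal ENNReal Pointwise MatrixGroups
open ValuativeRel
open Literature.NumberTheory Literature.NumberTheory.Rogawski1990 Literature.NumberTheory.Automorphic Literature.NumberTheory.Automorphic.UnitaryGroup
open Summit.HodgeConjecture.HodgeConjecture.Cruxes.H413 Summit.HodgeConjecture.HodgeConjecture.Cruxes.H413.F0P3cStCharTSTorusDefs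

namespace Summit.HodgeConjecture.HodgeConjecture.Cruxes.H413.F0P3cStCharTSShellValue

variable (L : Type) [Field L] [NumberField L] [IsCMField L] (v : HeightOneSpectrum (𝓞 ↥(maximalRealSubfield L)))
  (w : PlacesOver L v) (hw : IsCMField.complexConj L • w.1 = w.1)

include hw in
set_option maxHeartbeats 4000000 in  -- cross-spelling `whnf` `Gqs L v` ≡ `↥(unitaryGroupOfForm … (cmLocalForm L 3 v))` (measured class, as ★ GValue ∕ ★ «SHELLS-TT»)
set_option synthInstance.maxHeartbeats 400000 in
/-- **«SHELL-VALUE★» — the point value of `ρ·(α ∘ ι)` at a dominant chart point from the Hecke-shell average of `α`.**  Under the binders of ★ `shellsTT_of_datum`, for a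
density `ρ` and a function `α` with (i) the Weyl identity at `φ = 𝟙_{K_n ι(u) K_n}`, (ii) `ρ·(α∘ι)` constant on `u·M_n`, (iii) `ρ·(α∘ι)` `ω`-invariant on `u·M_n`:
`(ρ u · α(ι u)) · (‖u₁‖ · ∫ φ dν) = ∫ φ·α dν`. [cite: Rogawski1990, §12.7 L. 12.7.2 (proof) p. 193; §12.5 p. 182] [cite: Casselman1977, Thm. 5.2] -/
theorem shellValue (hns : ∀ w' : PlacesOver L v, IsCMField.complexConj L • w'.1 = w'.1)
    [MeasurableSpace (Gqs L v)] [BorelSpace (Gqs L v)]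
    [∀ γ : Gqs L v, MeasurableSpace (Gqs L v ⧸ Subgroup.centralizer ({γ} : Set (Gqs L v)))]
    [∀ γ : Gqs L v, BorelSpace (Gqs L v ⧸ Subgroup.centralizer ({γ} : Set (Gqs L v)))]
    (νQv : Measure (Gqs L v)) [νQv.IsHaarMeasure] [νQv.IsMulRightInvariant]
    {mQv : OrbitalMeasureFamily (Gqs L v)} (hcanQ : mQv.IsCanonical (fun γ => IsRegularElt (γ.val : GL (Fin 3) (UnitaryGroup.LocalRing L v))) νQv)
    [MeasurableSpace ↥(unitaryGroupOfForm (conjLocal L (IsCMField.complexConj L) v) (cmLocalForm L 3 v))] [BorelSpace ↥(unitaryGroupOfForm (conjLocal L (IsCMField.complexConj L) v) (cmLocalForm L 3 v))]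
    [MeasurableSpace ((UnitaryGroup.LocalRing L v)ˣ × ↥(normOneUnits (conjLocal L (IsCMField.complexConj L) v)))] [BorelSpace ((UnitaryGroup.LocalRing L v)ˣ × ↥(normOneUnits (conjLocal L (IsCMField.complexConj L) v)))]
    (μM : Measure ((UnitaryGroup.LocalRing L v)ˣ × ↥(normOneUnits (conjLocal L (IsCMField.complexConj L) v)))) [μM.IsHaarMeasure]
    (𝓘 : (cmBorelTriple L 3 v).IwahoriDatum)
    (hKint : ∀ n, ∀ k ∈ 𝓘.K n, k ∈ cmLocalIntegralLevel L 3 (Matrix.of fun i j : Fin 3 => if i.val + j.val + 1 = 3 then (1 : L) else 0) v)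
    (n : ℕ) {r : WithZero (Multiplicative ℤ)} (hr : r < 1)
    (hKr : ∀ k ∈ 𝓘.K n, ∀ i j : Fin 3, Valued.v ((((k : GL (Fin 3) (LocalRing L v)).val i j - (1 : Matrix (Fin 3) (Fin 3) (LocalRing L v)) i j) : LocalRing L v) w) ≤ r)
    (w₀ : ↥(unitaryGroupOfForm (conjLocal L (IsCMField.complexConj L) v) (cmLocalForm L 3 v))) (hw₀ : Units.val (w₀ : GL (Fin 3) (LocalRing L v)) = cmLocalForm L 3 v)
    (hKw : ∀ κ ∈ 𝓘.K n, w₀ * κ * w₀⁻¹ ∈ 𝓘.K n)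
    (u : ((UnitaryGroup.LocalRing L v)ˣ × ↥(normOneUnits (conjLocal L (IsCMField.complexConj L) v)))) (hu : Valued.v ((u.1 : LocalRing L v) w) < 1)
    (hbN : ∀ x ∈ 𝓘.K n ⊓ (cmBorelTriple L 3 v).N,
        ((F0P3cStCharTSTorusDefs.torusChart L v u : ↥(cmBorelTriple L 3 v).M) : ↥(unitaryGroupOfForm (conjLocal L (IsCMField.complexConj L) v) (cmLocalForm L 3 v))) * x *
          ((F0P3cStCharTSTorusDefs.torusChart L v u : ↥(cmBorelTriple L 3 v).M) : ↥(unitaryGroupOfForm (conjLocal L (IsCMField.complexConj L) v) (cmLocalForm L 3 v)))⁻¹ ∈ 𝓘.K n)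
    (hbNbar : ∀ x ∈ 𝓘.K n ⊓ 𝓘.Nbar,
        ((F0P3cStCharTSTorusDefs.torusChart L v u : ↥(cmBorelTriple L 3 v).M) : ↥(unitaryGroupOfForm (conjLocal L (IsCMField.complexConj L) v) (cmLocalForm L 3 v)))⁻¹ * x *
          ((F0P3cStCharTSTorusDefs.torusChart L v u : ↥(cmBorelTriple L 3 v).M) : ↥(unitaryGroupOfForm (conjLocal L (IsCMField.complexConj L) v) (cmLocalForm L 3 v))) ∈ 𝓘.K n ⊓ 𝓘.Nbar)
    (hbexh : ∀ x ∈ (cmBorelTriple L 3 v).N, ∃ k : ℕ, ∀ k', k ≤ k' →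
        ((F0P3cStCharTSTorusDefs.torusChart L v u : ↥(cmBorelTriple L 3 v).M) : ↥(unitaryGroupOfForm (conjLocal L (IsCMField.complexConj L) v) (cmLocalForm L 3 v))) ^ k' * x *
          (((F0P3cStCharTSTorusDefs.torusChart L v u : ↥(cmBorelTriple L 3 v).M) : ↥(unitaryGroupOfForm (conjLocal L (IsCMField.complexConj L) v) (cmLocalForm L 3 v))) ^ k')⁻¹ ∈ 𝓘.K n)
    {R : Finset ↥(unitaryGroupOfForm (conjLocal L (IsCMField.complexConj L) v) (cmLocalForm L 3 v))}
    (hR : IsLeftTransversal (𝓘.K n) (𝓘.K n ⊓ ConjAct.toConjAct ((F0P3cStCharTSTorusDefs.torusChart L v u : ↥(cmBorelTriple L 3 v).M) : ↥(unitaryGroupOfForm (conjLocal L (IsCMField.complexConj L) v) (cmLocalForm L 3 v))) • 𝓘.K n) R)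
    (ρ : ((UnitaryGroup.LocalRing L v)ˣ × ↥(normOneUnits (conjLocal L (IsCMField.complexConj L) v))) → ℝ) (α : Gqs L v → ℂ)
    (hWIFφ : ∫ g, ((DoubleCoset.doubleCoset ((torusChart L v u : ↥(cmBorelTriple L 3 v).M) : ↥(unitaryGroupOfForm (conjLocal L (IsCMField.complexConj L) v) (cmLocalForm L 3 v))) (𝓘.K n : Set ↥(unitaryGroupOfForm (conjLocal L (IsCMField.complexConj L) v) (cmLocalForm L 3 v))) (𝓘.K n : Set ↥(unitaryGroupOfForm (conjLocal L (IsCMField.complexConj L) v) (cmLocalForm L 3 v)))).indicator (fun _ => (1 : ℂ)) : Gqs L v → ℂ) g * α g ∂νQv =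
      ∫ m, torusTransform L v mQv μM ((DoubleCoset.doubleCoset ((torusChart L v u : ↥(cmBorelTriple L 3 v).M) : ↥(unitaryGroupOfForm (conjLocal L (IsCMField.complexConj L) v) (cmLocalForm L 3 v))) (𝓘.K n : Set ↥(unitaryGroupOfForm (conjLocal L (IsCMField.complexConj L) v) (cmLocalForm L 3 v))) (𝓘.K n : Set ↥(unitaryGroupOfForm (conjLocal L (IsCMField.complexConj L) v) (cmLocalForm L 3 v)))).indicator (fun _ => (1 : ℂ)) : Gqs L v → ℂ) m * ((ρ m : ℂ) * α (((torusChart L v m : ↥(cmBorelTriple L 3 v).M) : ↥(unitaryGroupOfForm (conjLocal L (IsCMField.complexConj L) v) (cmLocalForm L 3 v))) : Gqs L v)) ∂μM)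
    (hconst : ∀ m ∈ u • ((((𝓘.K n).subgroupOf (cmBorelTriple L 3 v).M).comap (torusChartHom L v) : Subgroup ((UnitaryGroup.LocalRing L v)ˣ × ↥(normOneUnits (conjLocal L (IsCMField.complexConj L) v)))) : Set ((UnitaryGroup.LocalRing L v)ˣ × ↥(normOneUnits (conjLocal L (IsCMField.complexConj L) v)))), (ρ m : ℂ) * α (((torusChart L v m : ↥(cmBorelTriple L 3 v).M) : ↥(unitaryGroupOfForm (conjLocal L (IsCMField.complexConj L) v) (cmLocalForm L 3 v))) : Gqs L v) = (ρ u : ℂ) * α (((torusChart L v u : ↥(cmBorelTriple L 3 v).M) : ↥(unitaryGroupOfForm (conjLocal L (IsCMField.complexConj L) v) (cmLocalForm L 3 v))) : Gqs L v))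
    (hω : ∀ m ∈ u • ((((𝓘.K n).subgroupOf (cmBorelTriple L 3 v).M).comap (torusChartHom L v) : Subgroup ((UnitaryGroup.LocalRing L v)ˣ × ↥(normOneUnits (conjLocal L (IsCMField.complexConj L) v)))) : Set ((UnitaryGroup.LocalRing L v)ˣ × ↥(normOneUnits (conjLocal L (IsCMField.complexConj L) v)))), (ρ ((fun p : ((UnitaryGroup.LocalRing L v)ˣ × ↥(normOneUnits (conjLocal L (IsCMField.complexConj L) v))) => ((Units.map ((conjLocal L (IsCMField.complexConj L) v : UnitaryGroup.LocalRing L v →+* UnitaryGroup.LocalRing L v) : UnitaryGroup.LocalRing L v →* UnitaryGroup.LocalRing L v) p.1)⁻¹, p.2)) m) : ℂ) * α (((torusChart L v ((fun p : ((UnitaryGroup.LocalRing L v)ˣ × ↥(normOneUnits (conjLocal L (IsCMField.complexConj L) v))) => ((Units.map ((conjLocal L (IsCMField.complexConj L) v : UnitaryGroup.LocalRing L v →+* UnitaryGroup.LocalRing L v) : UnitaryGroup.LocalRing L v →* UnitaryGroup.LocalRing L v) p.1)⁻¹, p.2)) m) : ↥(cmBorelTriple L 3 v).M) : ↥(unitaryGroupOfForm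 (conjLocal L (IsCMField.complexConj L) v) (cmLocalForm L 3 v))) : Gqs L v) = (ρ m : ℂ) * α (((torusChart L v m : ↥(cmBorelTriple L 3 v).M) : ↥(unitaryGroupOfForm (conjLocal L (IsCMField.complexConj L) v) (cmLocalForm L 3 v))) : Gqs L v)) :
    ((ρ u : ℂ) * α (((torusChart L v u : ↥(cmBorelTriple L 3 v).M) : ↥(unitaryGroupOfForm (conjLocal L (IsCMField.complexConj L) v) (cmLocalForm L 3 v))) : Gqs L v)) * ((((unitModulusChar (LocalRing L v) u.1 : ℝ≥0) : ℝ) : ℂ) * ∫ g, ((DoubleCoset.doubleCoset ((torusChart L v u : ↥(cmBorelTriple L 3 v).M) : ↥(unitaryGroupOfForm (conjLocal L (IsCMField.complexConj L) v) (cmLocalForm L 3 v))) (𝓘.K n : Set ↥(unitaryGroupOfForm (conjLocal L (IsCMField.complexConj L) v) (cmLocalForm L 3 v))) (𝓘.K n : Set ↥(unitaryGroupOfForm (conjLocal L (IsCMField.complexConj L) v) (cmLocalForm L 3 v)))).indicator (fun _ => (1 : ℂ)) : Gqs L v → ℂ) g ∂νQv) =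
      ∫ g, ((DoubleCoset.doubleCoset ((torusChart L v u : ↥(cmBorelTriple L 3 v).M) : ↥(unitaryGroupOfForm (conjLocal L (IsCMField.complexConj L) v) (cmLocalForm L 3 v))) (𝓘.K n : Set ↥(unitaryGroupOfForm (conjLocal L (IsCMField.complexConj L) v) (cmLocalForm L 3 v))) (𝓘.K n : Set ↥(unitaryGroupOfForm (conjLocal L (IsCMField.complexConj L) v) (cmLocalForm L 3 v)))).indicator (fun _ => (1 : ℂ)) : Gqs L v → ℂ) g * α g ∂νQv := by
  haveI := locallyCompactSpace_cmBorelU L 3 v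
  obtain ⟨-, -, -, hT, hmass⟩ := F0P3cStCharTSShellsTT.shellsTT_of_datum L v w hw hns νQv hcanQ μM 𝓘 hKint n hr hKr w₀ hw₀ hKw u hu hbN hbNbar hbexh hR
  -- names
  set S : Set ((UnitaryGroup.LocalRing L v)ˣ × ↥(normOneUnits (conjLocal L (IsCMField.complexConj L) v))) := u • ((((𝓘.K n).subgroupOf (cmBorelTriple L 3 v).M).comap (torusChartHom L v) : Subgroup ((UnitaryGroup.LocalRing L v)ˣ × ↥(normOneUnits (conjLocal L (IsCMField.complexConj L) v)))) : Set ((UnitaryGroup.LocalRing L v)ˣ × ↥(normOneUnits (conjLocal L (IsCMField.complexConj L) v)))) with hSdef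
  set ω : ((UnitaryGroup.LocalRing L v)ˣ × ↥(normOneUnits (conjLocal L (IsCMField.complexConj L) v))) → ((UnitaryGroup.LocalRing L v)ˣ × ↥(normOneUnits (conjLocal L (IsCMField.complexConj L) v))) := (fun p : ((UnitaryGroup.LocalRing L v)ˣ × ↥(normOneUnits (conjLocal L (IsCMField.complexConj L) v))) => ((Units.map ((conjLocal L (IsCMField.complexConj L) v : UnitaryGroup.LocalRing L v →+* UnitaryGroup.LocalRing L v) : UnitaryGroup.LocalRing L v →* UnitaryGroup.LocalRing L v) p.1)⁻¹, p.2)) with hωdef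
  set X : ℂ := (ρ u : ℂ) * α (((torusChart L v u : ↥(cmBorelTriple L 3 v).M) : ↥(unitaryGroupOfForm (conjLocal L (IsCMField.complexConj L) v) (cmLocalForm L 3 v))) : Gqs L v) with hXdef
  -- the coset `S = u·M_n`: open (hence measurable) and of finite measure
  have hSo : IsOpen S := (F0P3cStCharTSLevelFamily.isOpen_levelFamily L v 𝓘 n).smul u
  have hSm : MeasurableSet S := hSo.measurableSet
  have hMc : IsCompact ((((𝓘.K n).subgroupOf (cmBorelTriple L 3 v).M).comap (torusChartHom L v) : Subgroup ((UnitaryGroup.LocalRing L v)ˣ × ↥(normOneUnits (conjLocal L (IsCMField.complexConj L) v)))) : Set ((UnitaryGroup.LocalRing L v)ˣ × ↥(normOneUnits (conjLocal L (IsCMField.complexConj L) v)))) :=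
    (F0P3cStCharTSTorusCompactPart.isCompact_torusCompactPart L v hns).of_isClosed_subset
      (Subgroup.isClosed_of_isOpen _ (F0P3cStCharTSLevelFamily.isOpen_levelFamily L v 𝓘 n)) (F0P3cStCharTSLevelFamily.levelFamily_le_torusCompactPart L v hns 𝓘 hKint n)
  have hSc : IsCompact S := hMc.smul u
  have hSfin : μM S < ⊤ := hSc.measure_lt_top
  -- `ω` is an involution preserving `μM`
  have hωω : ∀ m, ω (ω m) = m := F0P3cStCharTSTorusRay.reflect_reflect L v
  have hωpre : μM (ω ⁻¹' S) = μM S := (F0P3cStCharTSTorusRay.measurePreserving_reflect L v μM).measure_preimage hSm.nullMeasurableSet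
  -- `F := ρ·(α∘ι)` equals `X` on `S` and on `ω⁻¹(S)`
  have hFS : ∀ m ∈ S, (ρ m : ℂ) * α (((torusChart L v m : ↥(cmBorelTriple L 3 v).M) : ↥(unitaryGroupOfForm (conjLocal L (IsCMField.complexConj L) v) (cmLocalForm L 3 v))) : Gqs L v) = X := fun m hm => hconst m hm
  have hFωS : ∀ m, ω m ∈ S → (ρ m : ℂ) * α (((torusChart L v m : ↥(cmBorelTriple L 3 v).M) : ↥(unitaryGroupOfForm (conjLocal L (IsCMField.complexConj L) v) (cmLocalForm L 3 v))) : Gqs L v) = X := by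
    intro m hm
    have h1 := hω (ω m) hm
    rw [hωω] at h1
    rw [h1]
    exact hconst (ω m) hm
  -- pointwise: `F_φ · F = κ·X·(𝟙_S + 𝟙_(ω⁻¹ S))`
  have hpt : ∀ m : ((UnitaryGroup.LocalRing L v)ˣ × ↥(normOneUnits (conjLocal L (IsCMField.complexConj L) v))),
      torusTransform L v mQv μM ((DoubleCoset.doubleCoset ((torusChart L v u : ↥(cmBorelTriple L 3 v).M) : ↥(unitaryGroupOfForm (conjLocal L (IsCMField.complexConj L) v) (cmLocalForm L 3 v))) (𝓘.K n : Set ↥(unitaryGroupOfForm (conjLocal L (IsCMField.complexConj L) v) (cmLocalForm L 3 v))) (𝓘.K n : Set ↥(unitaryGroupOfForm (conjLocal L (IsCMField.complexConj L) v) (cmLocalForm L 3 v)))).indicator (fun _ => (1 : ℂ)) : Gqs L v → ℂ) m * ((ρ m : ℂ) * α (((torusChart L v m : ↥(cmBorelTriple L 3 v).M) : ↥(unitaryGroupOfForm (conjLocal L (IsCMField.complexConj L) v) (cmLocalForm L 3 v))) : Gqs L v)) =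
        ((((2 * μM.real ((((Submonoid.pi Set.univ (fun w : PlacesOver L v => (w.1.adicCompletionIntegers L).toSubring.toSubmonoid)).units.prod (⊤ : Subgroup ↥(normOneUnits (conjLocal L (IsCMField.complexConj L) v)))) : Subgroup ((UnitaryGroup.LocalRing L v)ˣ × ↥(normOneUnits (conjLocal L (IsCMField.complexConj L) v)))) : Set ((UnitaryGroup.LocalRing L v)ˣ × ↥(normOneUnits (conjLocal L (IsCMField.complexConj L) v)))))⁻¹ : ℝ) : ℂ) *
        ((((((νQv.map (cmDatumLocalCongr L v (1 : GL (Fin 3) (LocalRing L v)) isUnit_one (F0P3cStCharTSDeltaAtLevi.formCongr_one_qsForm L v)).symm : Measure ↥(unitaryGroupOfForm (conjLocal L (IsCMField.complexConj L) v) (cmLocalForm L 3 v)))).real ((𝓘.K n) : Set ↥(unitaryGroupOfForm (conjLocal L (IsCMField.complexConj L) v) (cmLocalForm L 3 v))) : ℂ) * (R.card : ℂ) * ((rootDeltaChar (cmBorelTriple L 3 v).P (Subgroup.inclusion (cmBorelTriple L 3 v).M_le (F0P3cStCharTSTorusDefs.torusChart L v u)) : ℂˣ) : ℂ)) * (((μM.map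 (F0P3cStCharTSTorusDefs.torusChart L v)).real {t : ↥(cmBorelTriple L 3 v).M | (t : ↥(unitaryGroupOfForm (conjLocal L (IsCMField.complexConj L) v) (cmLocalForm L 3 v))) ∈ cmLocalIntegralLevel L 3 (Matrix.of fun i j : Fin 3 => if i.val + j.val + 1 = 3 then (1 : L) else 0) v} : ℝ) : ℂ)) / (((μM.map (F0P3cStCharTSTorusDefs.torusChart L v)).real (((𝓘.K n).subgroupOf (cmBorelTriple L 3 v).M) : Set ↥(cmBorelTriple L 3 v).M) : ℝ) : ℂ))) * X *
          (S.indicator (fun _ => (1 : ℂ)) m + (ω ⁻¹' S).indicator (fun _ => (1 : ℂ)) m) := by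
    intro m
    rw [hT]
    show _ * (S.indicator (fun _ => (1 : ℂ)) m + S.indicator (fun _ => (1 : ℂ)) (ω m)) * _ = _
    by_cases hm : m ∈ S
    · by_cases hm' : ω m ∈ S
      · rw [Set.indicator_of_mem hm, Set.indicator_of_mem hm', Set.indicator_of_mem (show m ∈ ω ⁻¹' S from hm'), hFS m hm]; ring
      · rw [Set.indicator_of_mem hm, Set.indicator_of_notMem hm', Set.indicator_of_notMem (show m ∉ ω ⁻¹' S from hm'), hFS m hm]; ring
    · by_cases hm' : ω m ∈ S
      · rw [Set.indicator_of_notMem hm, Set.indicator_of_mem hm', Set.indicator_of_mem (show m ∈ ω ⁻¹' S from hm'), hFωS m hm']; ring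
      · rw [Set.indicator_of_notMem hm, Set.indicator_of_notMem hm', Set.indicator_of_notMem (show m ∉ ω ⁻¹' S from hm')]; ring
  -- integrate
  have hωmeas : Measurable ω := (F0P3cStCharTSTorusRay.continuous_reflect L v).measurable
  have hωpre' : μM.real (ω ⁻¹' S) = μM.real S := by simp only [measureReal_def, hωpre]
  have hI1 : ∫ m, S.indicator (fun _ => (1 : ℂ)) m ∂μM = (μM.real S : ℂ) := by
    rw [integral_indicator_const (1 : ℂ) hSm, Complex.real_smul, mul_one]
  have hI2 : ∫ m, (ω ⁻¹' S).indicator (fun _ => (1 : ℂ)) m ∂μM = (μM.real S : ℂ) := by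
    rw [integral_indicator_const (1 : ℂ) (hSm.preimage hωmeas), hωpre', Complex.real_smul, mul_one]
  have hi1 : Integrable (S.indicator (fun _ => (1 : ℂ))) μM := (integrable_indicator_iff hSm).2 (integrableOn_const hSfin.ne)
  have hi2 : Integrable ((ω ⁻¹' S).indicator (fun _ => (1 : ℂ))) μM :=
    (integrable_indicator_iff (hSm.preimage hωmeas)).2 (integrableOn_const (by rw [hωpre]; exact hSfin.ne))
  have hint : ∫ m, torusTransform L v mQv μM ((DoubleCoset.doubleCoset ((torusChart L v u : ↥(cmBorelTriple L 3 v).M) : ↥(unitaryGroupOfForm (conjLocal L (IsCMField.complexConj L) v) (cmLocalForm L 3 v))) (𝓘.K n : Set ↥(unitaryGroupOfForm (conjLocal L (IsCMField.complexConj L) v) (cmLocalForm L 3 v))) (𝓘.K n : Set ↥(unitaryGroupOfForm (conjLocal L (IsCMField.complexConj L) v) (cmLocalForm L 3 v)))).indicator (fun _ => (1 : ℂ)) : Gqs L v → ℂ) m * ((ρ m : ℂ) * α (((torusChart L v m : ↥(cmBorelTriple L 3 v).M) : ↥(unitaryGroupOfForm (conjLocal L (IsCMField.complexConj L) v) (cmLocalForm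 L 3 v))) : Gqs L v)) ∂μM =
      ((((2 * μM.real ((((Submonoid.pi Set.univ (fun w : PlacesOver L v => (w.1.adicCompletionIntegers L).toSubring.toSubmonoid)).units.prod (⊤ : Subgroup ↥(normOneUnits (conjLocal L (IsCMField.complexConj L) v)))) : Subgroup ((UnitaryGroup.LocalRing L v)ˣ × ↥(normOneUnits (conjLocal L (IsCMField.complexConj L) v)))) : Set ((UnitaryGroup.LocalRing L v)ˣ × ↥(normOneUnits (conjLocal L (IsCMField.complexConj L) v)))))⁻¹ : ℝ) : ℂ) *
        ((((((νQv.map (cmDatumLocalCongr L v (1 : GL (Fin 3) (LocalRing L v)) isUnit_one (F0P3cStCharTSDeltaAtLevi.formCongr_one_qsForm L v)).symm : Measure ↥(unitaryGroupOfForm (conjLocal L (IsCMField.complexConj L) v) (cmLocalForm L 3 v)))).real ((𝓘.K n) : Set ↥(unitaryGroupOfForm (conjLocal L (IsCMField.complexConj L) v) (cmLocalForm L 3 v))) : ℂ) * (R.card : ℂ) * ((rootDeltaChar (cmBorelTriple L 3 v).P (Subgroup.inclusion (cmBorelTriple L 3 v).M_le (F0P3cStCharTSTorusDefs.torusChart L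 v u)) : ℂˣ) : ℂ)) * (((μM.map (F0P3cStCharTSTorusDefs.torusChart L v)).real {t : ↥(cmBorelTriple L 3 v).M | (t : ↥(unitaryGroupOfForm (conjLocal L (IsCMField.complexConj L) v) (cmLocalForm L 3 v))) ∈ cmLocalIntegralLevel L 3 (Matrix.of fun i j : Fin 3 => if i.val + j.val + 1 = 3 then (1 : L) else 0) v} : ℝ) : ℂ)) / (((μM.map (F0P3cStCharTSTorusDefs.torusChart L v)).real (((𝓘.K n).subgroupOf (cmBorelTriple L 3 v).M) : Set ↥(cmBorelTriple L 3 v).M) : ℝ) : ℂ))) * X * (2 * (μM.real S : ℂ)) := by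
    rw [show (fun m => torusTransform L v mQv μM ((DoubleCoset.doubleCoset ((torusChart L v u : ↥(cmBorelTriple L 3 v).M) : ↥(unitaryGroupOfForm (conjLocal L (IsCMField.complexConj L) v) (cmLocalForm L 3 v))) (𝓘.K n : Set ↥(unitaryGroupOfForm (conjLocal L (IsCMField.complexConj L) v) (cmLocalForm L 3 v))) (𝓘.K n : Set ↥(unitaryGroupOfForm (conjLocal L (IsCMField.complexConj L) v) (cmLocalForm L 3 v)))).indicator (fun _ => (1 : ℂ)) : Gqs L v → ℂ) m * ((ρ m : ℂ) * α (((torusChart L v m : ↥(cmBorelTriple L 3 v).M) : ↥(unitaryGroupOfForm (conjLocal L (IsCMField.complexConj L) v) (cmLocalForm L 3 v))) : Gqs L v))) =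
        fun m => ((((2 * μM.real ((((Submonoid.pi Set.univ (fun w : PlacesOver L v => (w.1.adicCompletionIntegers L).toSubring.toSubmonoid)).units.prod (⊤ : Subgroup ↥(normOneUnits (conjLocal L (IsCMField.complexConj L) v)))) : Subgroup ((UnitaryGroup.LocalRing L v)ˣ × ↥(normOneUnits (conjLocal L (IsCMField.complexConj L) v)))) : Set ((UnitaryGroup.LocalRing L v)ˣ × ↥(normOneUnits (conjLocal L (IsCMField.complexConj L) v)))))⁻¹ : ℝ) : ℂ) *
        ((((((νQv.map (cmDatumLocalCongr L v (1 : GL (Fin 3) (LocalRing L v)) isUnit_one (F0P3cStCharTSDeltaAtLevi.formCongr_one_qsForm L v)).symm : Measure ↥(unitaryGroupOfForm (conjLocal L (IsCMField.complexConj L) v) (cmLocalForm L 3 v)))).real ((𝓘.K n) : Set ↥(unitaryGroupOfForm (conjLocal L (IsCMField.complexConj L) v) (cmLocalForm L 3 v))) : ℂ) * (R.card : ℂ) * ((rootDeltaChar (cmBorelTriple L 3 v).P (Subgroup.inclusion (cmBorelTriple L 3 v).M_le (F0P3cStCharTSTorusDefs.torusChart L v u)) : ℂˣ) : ℂ)) *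 (((μM.map (F0P3cStCharTSTorusDefs.torusChart L v)).real {t : ↥(cmBorelTriple L 3 v).M | (t : ↥(unitaryGroupOfForm (conjLocal L (IsCMField.complexConj L) v) (cmLocalForm L 3 v))) ∈ cmLocalIntegralLevel L 3 (Matrix.of fun i j : Fin 3 => if i.val + j.val + 1 = 3 then (1 : L) else 0) v} : ℝ) : ℂ)) / (((μM.map (F0P3cStCharTSTorusDefs.torusChart L v)).real (((𝓘.K n).subgroupOf (cmBorelTriple L 3 v).M) : Set ↥(cmBorelTriple L 3 v).M) : ℝ) : ℂ))) * X *
          (S.indicator (fun _ => (1 : ℂ)) m + (ω ⁻¹' S).indicator (fun _ => (1 : ℂ)) m) from funext hpt,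
      integral_const_mul, integral_add hi1 hi2, hI1, hI2]
    ring
  -- `δ_B^{1∕2}(ι u) = ‖u₁‖`
  have hδ : ((rootDeltaChar (cmBorelTriple L 3 v).P (Subgroup.inclusion (cmBorelTriple L 3 v).M_le (torusChart L v u)) : ℂˣ) : ℂ) =
      (((unitModulusChar (LocalRing L v) u.1 : ℝ≥0) : ℝ) : ℂ) := by
    have h := F0P2oBorelTorusModulus.rootDeltaChar_cmBorel_torus L v (torusChart L v u)
    rw [torusEntry_zero_torusChart] at h
    exact h
  have hne0 : unitModulusChar (LocalRing L v) u.1 ≠ 0 := by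
    have h1 : unitModulusChar (LocalRing L v) u.1 * unitModulusChar (LocalRing L v) u.1⁻¹ = 1 := by rw [← map_mul, mul_inv_cancel, map_one]
    exact left_ne_zero_of_mul_eq_one h1
  have hne : (((unitModulusChar (LocalRing L v) u.1 : ℝ≥0) : ℝ) : ℂ) ≠ 0 := Complex.ofReal_ne_zero.2 (NNReal.coe_ne_zero.2 hne0)
  rw [hWIFφ, hint, hmass, hδ]
  field_simp

end Summit.HodgeConjecture.HodgeConjecture.Cruxes.H413.F0P3cStCharTSShellValue

end
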